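import Literature.MathematicalPhysics.QuantumLattice.DWaveSourceNNNHopping
import HarnessLib

/-!
# The window Hamiltonian of the pair-sourced `t–t'` Hubbard model, its torus locality and the
# translation sum of its local objective

Topic `MathematicalPhysics/QuantumLattice`, family `hubbard`. Sequel of
`DWaveSourceWindowHamiltonian.lean` / `DWaveSourceWindowCertificate.lean` (nearest-neighbour hopping) and
`HubbardNNNHoppingLocalHamiltonian.lean` (the particle-number conserving `t–t'` model), for the PINNING-FIELD
`t–t'` torus `A_L = dWaveSourceTorusTT' L tp U μ h = H^{tt'}_L(1,tp,U) − μN − h(Δ_d + Δ_d†)`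
(`DWaveSourceNNNHopping.lean`; Xu et al. 2024 eq. (1) with the Koma–Tasaki source, 1994 §1):

* `pairSourceWindowHamiltonianTT' g Λ' tp U μ h = pairSourceWindowHamiltonian g Λ' U μ h
   + (diagHoppingFermionInteraction tp).localHamiltonian Λ'` — the free-boundary sourced `t–t'` window
  Hamiltonian `H^{tt'}_{Λ'}(1,tp,U) − μ N_{Λ'} − h (S_{Λ'} + S_{Λ'}ᴴ)` (`pairSourceWindowHamiltonianTT'_eq`);
* GRADED LOCALITY seen from an inner region `Λ` with all eight king-move neighbours in `Λ'`
  (`thicken Λ 1 ⊆ Λ'`, `x ↦ x mod L` injective on `thicken Λ' 1`):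
  `A_L − Γ(H^{src,tt'}_{Λ'})` is even and supported off `Γ(𝔄_Λ)`
  (`dWaveSourceTorusTT'_sub_fermionEmbed_mem_carEvenSubalgebra`), hence
  `[A_L, Γ B] = Γ([H^{src,tt'}_{Λ'}, B])` for `B ∈ 𝔄_Λ` (`dWaveSourceTorusTT'_commutator_fermionEmbed`) —
  Han's stationarity constraints `⟨[H,O]⟩ = 0` (2020 §3), computed in the window, are exact on every large
  torus (Bratteli–Robinson II §5.2.2, Thm. 6.2.4);
* THE OBJECTIVE: the torus translates of the pulled-back local objective
  `E^{src,tt'} = Γ(incl) E^{tt'}_Φ − μ Σ_σ n_{0σ} − h (Γ(incl) Φ₀ + (Γ(incl) Φ₀)ᴴ)` sum to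
  `H^{tt'}_L − μ N_L − h (Δ_g + Δ_gᴴ)` (`sum_conj_fockTranslate_pairSourceObjectiveTT'`,
  Bratteli–Robinson II §6.2.4), i.e. to `A_L` for `g = dWaveFormFactor` (`…_dWave`).

These are the three inputs of the window (thermodynamic-limit bootstrap) certificate theorems for the
sourced `t–t'` model (`DWaveSourceNNNHoppingWindowCertificate.lean`). Everything is PROVED; the only
definition is the window Hamiltonian; no named fact; nothing here bears on `d`-wave order.

## References
* T. Koma, H. Tasaki, J. Stat. Phys. 76 (1994) 745–803, §1. [cite: KomaTasaki1994, §1]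
* H. Xu et al., Science 384 (2024) eadh7691, eq. (1). [cite: XuEtAl2024, eq. (1)]
* X. Han, arXiv:2006.06002 (2020), §3. [cite: Han2020Bootstrap, §3]
* O. Bratteli, D. W. Robinson, *Operator Algebras and Quantum Statistical Mechanics II*, 2nd ed.,
  §5.2.2, §6.2.4. [cite: BratteliRobinsonII1997, §6.2.4]
-/

noncomputable section

namespace Literature.MathematicalPhysics.QuantumLattice

open Matrix Finset HubbardWave0 Literature.Probability.LatticeModels
open Literature.MathematicalPhysics.QuantumManyBody.StateRelaxation
open scoped ComplexOrder BigOperators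

section Window

variable (g : Site 2 → ℝ)

/-- **The pair-sourced `t–t'` WINDOW Hamiltonian** of a finite window `Λ' ⊆ ℤ²`:
`H^{src,tt'}_{Λ'} = H^{tt'}_{Λ'}(1,tp,U) − μ N_{Λ'} − h (S_{Λ'} + S_{Λ'}ᴴ)`, realised as the nearest-neighbour
sourced window Hamiltonian plus the free-boundary diagonal-hopping Hamiltonian of `Λ'` (Xu et al. 2024
eq. (1) restricted to the window, with the Koma–Tasaki source). [cite: KomaTasaki1994, §1] -/
def pairSourceWindowHamiltonianTT' (Λ' : Finset (Site 2)) (tp U μ h : ℝ) : FermionOp Λ' :=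
  pairSourceWindowHamiltonian g Λ' U μ h + (diagHoppingFermionInteraction tp).localHamiltonian Λ'

/-- `H^{src,tt'}_{Λ'} = H^{tt'}_{Λ'}(1,tp,U) − μ N_{Λ'} − h (S_{Λ'} + S_{Λ'}ᴴ)` with the `t–t'` local
Hamiltonian `(hubbardTTPrimeFermionInteraction 1 tp U).localHamiltonian Λ'`. [cite: XuEtAl2024, eq. (1)] -/
theorem pairSourceWindowHamiltonianTT'_eq (Λ' : Finset (Site 2)) (tp U μ h : ℝ) :
    pairSourceWindowHamiltonianTT' g Λ' tp U μ h =
      (hubbardTTPrimeFermionInteraction 1 tp U).localHamiltonian Λ' - (μ : ℂ) • (totalNumber : FermionOp Λ') -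
        (h : ℂ) • (pairSourceWindow g Λ' + (pairSourceWindow g Λ')ᴴ) := by
  rw [pairSourceWindowHamiltonianTT', pairSourceWindowHamiltonian, hubbardTTPrimeFermionInteraction_localHamiltonian]
  abel

variable (L : ℕ) [NeZero L]

/-! ### Locality of the sourced `t–t'` torus Hamiltonian seen from an inner region -/

/-- **`A_L − Γ(H^{src,tt'}_{Λ'})` is even and supported off `Γ(𝔄_Λ)`** (`A_L = dWaveSourceTorusTT' L tp U μ h`):
for `Λ ⊆ Λ'` with `thicken Λ 1 ⊆ Λ'` and `x ↦ x mod L` injective on `thicken Λ' 1` — the sum of the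
nearest-neighbour sourced statement (`dWaveSourceTorus_sub_fermionEmbed_mem_carEvenSubalgebra`) and the
diagonal-hopping one (`diagHamiltonian_sub_fermionEmbed_localHamiltonian_mem_carEvenSubalgebra`).
[cite: BratteliRobinsonII1997, §6.2.1 and §5.2.2] -/
theorem dWaveSourceTorusTT'_sub_fermionEmbed_mem_carEvenSubalgebra {Λ Λ' : Finset (Site 2)} (hΛ : Λ ⊆ Λ')
    (h8 : thicken Λ 1 ⊆ Λ') (hInj : Set.InjOn (Torus.proj (d := 2) L) ↑(thicken Λ' 1)) (tp U μ h : ℝ) :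
    dWaveSourceTorusTT' L tp U μ h -
        fermionEmbed (PolySite.toTorusEmb L (hInj.mono (by exact_mod_cast subset_thicken Λ' 1)))
          (pairSourceWindowHamiltonianTT' dWaveFormFactor Λ' tp U μ h) ∈
      carEvenSubalgebra (orbs (Λ.image fun x => FermionTorus.ofTorusSite (Torus.proj L x)))ᶜ := by
  obtain ⟨hclosed, hclosedD⟩ := neighbours_mem_of_thicken_subset h8
  have e : dWaveSourceTorusTT' L tp U μ h -
      fermionEmbed (PolySite.toTorusEmb L (hInj.mono (by exact_mod_cast subset_thicken Λ' 1)))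
        (pairSourceWindowHamiltonianTT' dWaveFormFactor Λ' tp U μ h) =
      (dWaveSourceTorus L U μ h -
          fermionEmbed (PolySite.toTorusEmb L (hInj.mono (by exact_mod_cast subset_thicken Λ' 1)))
            (pairSourceWindowHamiltonian dWaveFormFactor Λ' U μ h)) +
        (hamiltonian (fermionTorusDiagGraph L) tp 0 -
          fermionEmbed (PolySite.toTorusEmb L (hInj.mono (by exact_mod_cast subset_thicken Λ' 1)))
            ((diagHoppingFermionInteraction tp).localHamiltonian Λ')) := by
    rw [dWaveSourceTorusTT'_eq_dWaveSourceTorus_add, pairSourceWindowHamiltonianTT', fermionEmbed_add]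
    abel
  rw [e]
  exact add_mem (dWaveSourceTorus_sub_fermionEmbed_mem_carEvenSubalgebra L hΛ hclosed hInj U μ h)
    (diagHamiltonian_sub_fermionEmbed_localHamiltonian_mem_carEvenSubalgebra L tp hΛ hclosedD hInj)

/-- **Locality of the sourced `t–t'` torus Hamiltonian seen from an inner region**: for `B ∈ 𝔄_Λ`,
`[A_L, Γ(B)] = Γ([H^{src,tt'}_{Λ'}, B])`. The commutator null terms of a window certificate for the
pinning-field problem (Han 2020 §3, `F[[H, O]] = 0`) are exact identities on every large torus.
[cite: Han2020Bootstrap, §3] -/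
theorem dWaveSourceTorusTT'_commutator_fermionEmbed {Λ Λ' : Finset (Site 2)} (hΛ : Λ ⊆ Λ')
    (h8 : thicken Λ 1 ⊆ Λ') (hInj : Set.InjOn (Torus.proj (d := 2) L) ↑(thicken Λ' 1)) (tp U μ h : ℝ)
    (A : FermionOp Λ) :
    dWaveSourceTorusTT' L tp U μ h *
          fermionEmbed (PolySite.toTorusEmb L (hInj.mono (by exact_mod_cast subset_thicken Λ' 1)))
            (fermionEmbed (PolySite.incl hΛ) A) -
        fermionEmbed (PolySite.toTorusEmb L (hInj.mono (by exact_mod_cast subset_thicken Λ' 1)))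
            (fermionEmbed (PolySite.incl hΛ) A) * dWaveSourceTorusTT' L tp U μ h =
      fermionEmbed (PolySite.toTorusEmb L (hInj.mono (by exact_mod_cast subset_thicken Λ' 1)))
        (pairSourceWindowHamiltonianTT' dWaveFormFactor Λ' tp U μ h * fermionEmbed (PolySite.incl hΛ) A -
          fermionEmbed (PolySite.incl hΛ) A * pairSourceWindowHamiltonianTT' dWaveFormFactor Λ' tp U μ h) := by
  have hInj' : Set.InjOn (Torus.proj (d := 2) L) ↑Λ' := hInj.mono (by exact_mod_cast subset_thicken Λ' 1)
  have hc : Commute (dWaveSourceTorusTT' L tp U μ h -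
      fermionEmbed (PolySite.toTorusEmb L hInj') (pairSourceWindowHamiltonianTT' dWaveFormFactor Λ' tp U μ h))
      (fermionEmbed (PolySite.toTorusEmb L hInj') (fermionEmbed (PolySite.incl hΛ) A)) := by
    rw [fermionEmbed_fermionEmbed]
    refine commute_of_mem_carEvenSubalgebra
      (dWaveSourceTorusTT'_sub_fermionEmbed_mem_carEvenSubalgebra L hΛ h8 hInj tp U μ h)
      (fermionEmbed_mem_carSubalgebra _ A) ?_
    exact disjoint_compl_left_iff.2 (orbs_map_incl_trans_toTorusEmb_subset L hΛ _)
  rw [Commute, SemiconjBy, sub_mul, mul_sub, sub_eq_sub_iff_sub_eq_sub] at hc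
  rw [fermionEmbed_sub, fermionEmbed_mul, fermionEmbed_mul]
  exact hc

/-! ### The translates of the sourced `t–t'` local objective -/

/-- **The translates of the sourced `t–t'` local objective sum to the sourced `t–t'` torus Hamiltonian**
(`L ≥ 3`): with `E^{src,tt'} = Γ(incl) E^{tt'}_Φ(1,tp,U) − μ Σ_σ n_{0σ} − h (Γ(incl) Φ₀ + (Γ(incl) Φ₀)ᴴ) ∈ 𝔄_{Λ'}`
(`Φ₀ = localPairAt {0,±e₁,±e₂} g 0`),
`Σ_{v ∈ (ℤ/L)²} U_v Γ(E^{src,tt'}) U_vᴴ = H^{tt'}_L(1,tp,U) − μ N_L − h (Δ_g + Δ_gᴴ)` — the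
nearest-neighbour statement `sum_conj_fockTranslate_pairSourceObjective` plus the diagonal mean-energy
observable (`sum_relabel_translate_diag_meanEnergyObs`). [cite: BratteliRobinsonII1997, §6.2.4] -/
theorem sum_conj_fockTranslate_pairSourceObjectiveTT' {Λ' : Finset (Site 2)}
    (h0 : thicken ({0} : Finset (Site 2)) 1 ⊆ Λ') (hz : (0 : Site 2) ∈ Λ')
    (hP : pairRegion (insert (0 : Site 2) unitSteps) 0 ⊆ Λ')
    (hInj' : Set.InjOn (Torus.proj (d := 2) L) ↑Λ') (hL : 3 ≤ L) (tp U μ h : ℝ) :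
    ∑ v : TorusSite 2 L, (fockTranslate v).val *
        fermionEmbed (PolySite.toTorusEmb L hInj')
          (fermionEmbed (PolySite.incl h0) ((hubbardTTPrimeFermionInteraction 1 tp U).meanEnergyObs 1) -
            (μ : ℂ) • ∑ σ : Fin 2, nAt 0 hz σ -
            (h : ℂ) • (fermionEmbed (PolySite.incl hP) (localPairAt (insert (0 : Site 2) unitSteps) g 0) +
              (fermionEmbed (PolySite.incl hP) (localPairAt (insert (0 : Site 2) unitSteps) g 0))ᴴ)) *
        (fockTranslate v).valᴴ =
      hubbardTorusTT' L 1 tp U - (μ : ℂ) • totalNumber - (h : ℂ) • (pairField g L + (pairField g L)ᴴ) := by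
  have h1 := sum_conj_fockTranslate_pairSourceObjective g L h0 hz hP hInj' hL U μ h
  -- the diagonal mean-energy observable and its translates
  have hD : fermionEmbed (PolySite.toTorusEmb L hInj')
      (fermionEmbed (PolySite.incl h0) ((diagHoppingFermionInteraction tp).meanEnergyObs 1)) =
      fermionEmbed (PolySite.toTorusEmb L (injOn_proj_thicken_one hL))
        ((diagHoppingFermionInteraction tp).meanEnergyObs 1) :=
    fermionEmbed_toTorusEmb_incl h0 hInj' _
  have h2 : ∑ v : TorusSite 2 L, (fockTranslate v).val *
      fermionEmbed (PolySite.toTorusEmb L hInj')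
        (fermionEmbed (PolySite.incl h0) ((diagHoppingFermionInteraction tp).meanEnergyObs 1)) *
      (fockTranslate v).valᴴ = hamiltonian (fermionTorusDiagGraph L) tp 0 := by
    rw [hD]
    have h := sum_relabel_translate_diag_meanEnergyObs (L := L) tp hL
    simp_rw [relabel_eq_fockRelabel_conj] at h
    exact h
  -- split the objective: `E^{src,tt'} = E^{src} + Γ(incl) D^{tp}_Φ`
  have hsplit : fermionEmbed (PolySite.incl h0) ((hubbardTTPrimeFermionInteraction 1 tp U).meanEnergyObs 1) -
      (μ : ℂ) • ∑ σ : Fin 2, nAt 0 hz σ -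
      (h : ℂ) • (fermionEmbed (PolySite.incl hP) (localPairAt (insert (0 : Site 2) unitSteps) g 0) +
        (fermionEmbed (PolySite.incl hP) (localPairAt (insert (0 : Site 2) unitSteps) g 0))ᴴ) =
      (fermionEmbed (PolySite.incl h0) ((hubbardFermionInteraction 2 1 U).meanEnergyObs 1) -
        (μ : ℂ) • ∑ σ : Fin 2, nAt 0 hz σ -
        (h : ℂ) • (fermionEmbed (PolySite.incl hP) (localPairAt (insert (0 : Site 2) unitSteps) g 0) +
          (fermionEmbed (PolySite.incl hP) (localPairAt (insert (0 : Site 2) unitSteps) g 0))ᴴ)) +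
        fermionEmbed (PolySite.incl h0) ((diagHoppingFermionInteraction tp).meanEnergyObs 1) := by
    rw [hubbardTTPrimeFermionInteraction_meanEnergyObs, fermionEmbed_add]
    abel
  have hstep : ∀ v : TorusSite 2 L, (fockTranslate v).val *
      fermionEmbed (PolySite.toTorusEmb L hInj')
        (fermionEmbed (PolySite.incl h0) ((hubbardTTPrimeFermionInteraction 1 tp U).meanEnergyObs 1) -
          (μ : ℂ) • ∑ σ : Fin 2, nAt 0 hz σ -
          (h : ℂ) • (fermionEmbed (PolySite.incl hP) (localPairAt (insert (0 : Site 2) unitSteps) g 0) +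
            (fermionEmbed (PolySite.incl hP) (localPairAt (insert (0 : Site 2) unitSteps) g 0))ᴴ)) *
      (fockTranslate v).valᴴ =
      (fockTranslate v).val *
          fermionEmbed (PolySite.toTorusEmb L hInj')
            (fermionEmbed (PolySite.incl h0) ((hubbardFermionInteraction 2 1 U).meanEnergyObs 1) -
              (μ : ℂ) • ∑ σ : Fin 2, nAt 0 hz σ -
              (h : ℂ) • (fermionEmbed (PolySite.incl hP) (localPairAt (insert (0 : Site 2) unitSteps) g 0) +
                (fermionEmbed (PolySite.incl hP) (localPairAt (insert (0 : Site 2) unitSteps) g 0))ᴴ)) *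
          (fockTranslate v).valᴴ +
        (fockTranslate v).val *
          fermionEmbed (PolySite.toTorusEmb L hInj')
            (fermionEmbed (PolySite.incl h0) ((diagHoppingFermionInteraction tp).meanEnergyObs 1)) *
          (fockTranslate v).valᴴ := by
    intro v
    rw [hsplit, fermionEmbed_add, Matrix.mul_add, Matrix.add_mul]
  rw [Finset.sum_congr rfl fun v _ => hstep v, Finset.sum_add_distrib, h1, h2, hubbardTorusTT',
    hubbardTorusWith_eq, hubbardTorus]
  abel

/-- For the `d_{x²−y²}` form factor the translates of the sourced `t–t'` local objective sum to
`dWaveSourceTorusTT' L tp U μ h`. [cite: KomaTasaki1994, §1] -/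
theorem sum_conj_fockTranslate_pairSourceObjectiveTT'_dWave {Λ' : Finset (Site 2)}
    (h0 : thicken ({0} : Finset (Site 2)) 1 ⊆ Λ') (hz : (0 : Site 2) ∈ Λ')
    (hP : pairRegion (insert (0 : Site 2) unitSteps) 0 ⊆ Λ')
    (hInj' : Set.InjOn (Torus.proj (d := 2) L) ↑Λ') (hL : 3 ≤ L) (tp U μ h : ℝ) :
    ∑ v : TorusSite 2 L, (fockTranslate v).val *
        fermionEmbed (PolySite.toTorusEmb L hInj')
          (fermionEmbed (PolySite.incl h0) ((hubbardTTPrimeFermionInteraction 1 tp U).meanEnergyObs 1) -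
            (μ : ℂ) • ∑ σ : Fin 2, nAt 0 hz σ -
            (h : ℂ) • (fermionEmbed (PolySite.incl hP) (localPairAt (insert (0 : Site 2) unitSteps) dWaveFormFactor 0) +
              (fermionEmbed (PolySite.incl hP) (localPairAt (insert (0 : Site 2) unitSteps) dWaveFormFactor 0))ᴴ)) *
        (fockTranslate v).valᴴ =
      dWaveSourceTorusTT' L tp U μ h := by
  rw [dWaveSourceTorusTT']
  exact sum_conj_fockTranslate_pairSourceObjectiveTT' dWaveFormFactor L h0 hz hP hInj' hL tp U μ h

end Window

end Literature.MathematicalPhysics.QuantumLattice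

end
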